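import Summits.MatrixMultiplication.MatrixMultiplication.Theorems.ObstructionDescentSchurWeylFormat
import Literature.Computability.AlgebraicComplexity.UnitTensorMomentPolytope
import Literature.Computability.AlgebraicComplexity.SmallFormatRank

set_option linter.dupNamespace false
set_option autoImplicit false

/-!
# Obstruction descent — the crux `P_O` splits EXACTLY into SATURATION and TORSION (decomp-mm · lens 3 · gen 30, def-free)

`route-MatrixMultiplication-ObstructionDescent`, crux `NoOccurrenceObstruction` (`P_O`, stmt 29040); NODE-g30.  Generation 29
certified the one translation of the lens, `P_O ⟺ ∀ τ > 2, eventually S(⟨n,n,n⟩) ⊆ S(⟨m₀⟩)`, `m₀(n,τ) = max(n², ⌈n^τ⌉)`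
(`noOccurrenceObstruction_iff_minFormat_semigroup`; `S(w) = {λ : λ occurs in w^{⊗d}}` the occurrence semigroup).  This file
is the split ONE LEVEL BELOW that translation.  A containment of occurrence semigroups `S(s) ⊆ S(t)` is the conjunction of

* **SAT** (no occurrence obstruction survives stretching): `λ ∈ S(s), d > 0 ⟹ ∃ k > 0, kλ ∈ S(t)` — in polytope language
  `Δ(s) ⊆ Δ(t)`; for `t = ⟨m⟩` it follows from the format-`m` unit-tensor moment-polytope maximality `Δ(⟨m⟩) = Kron(m,m,m)`
  (Bürgisser–Ikenmeyer 2011 Problem 8.3; known for `m ≤ 4`, tree fact `vandenBergEtAl2025_unitTensor_four_polytope_maximal`,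
  open for `m ≥ 5`), a statement that does not mention matrix multiplication; and
* **TOR** (relative saturation, "no torsion obstruction"): `λ ∈ S(s), k > 0, kλ ∈ S(t) ⟹ λ ∈ S(t)` — the holes of the
  semigroup `S(t)` (BI 2011 Lemma 6.1; the non-normality phenomena of BI 2017 §5) are invisible from `S(s)`;

glued both ways by two lines of logic (`semigroup_le_iff_sat_and_tor`; the degree-`0` triple occurs in every tensor,
`isotypicSum₁₂₃_kroneckerPow_zero_ne_zero`).  Hence (`noOccurrenceObstruction_iff_sat_and_tor`)

  `P_O  ⟺  SAT-family ∧ TOR-family`,  each family `∀ τ > 2, ∃ n₀, ∀ n ≥ n₀, (…)(⟨n,n,n⟩, ⟨m₀(n,τ)⟩)`,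

and the SAT-family follows from unit-tensor polytope maximality at all large formats (`sat_family_of_unitTensor_polytope_maximal`).
The split is GENUINE, not a renaming: at `n = 2` SAT holds at EVERY format `m ≥ 4` (`sat_two_of_four_polytope_maximal`, from the
`4×4×4` maximality), while the containment — hence TOR — fails at `m ∈ {4,5}` as soon as one triple occurs in `⟨2,2,2⟩^{⊗d}` but not
in `⟨5⟩^{⊗d}` (`not_tor_two_of_witness`; BI 2011 Lemma 6.1 supplies `λ₂ = ((5,1,1,1),(2⁴),(2⁴)) ⊢ 8`, tree theorem
`burgisserIkenmeyer2011_lemma_6_1_holds`), and both hold at `m ≥ 7 = R(⟨2,2,2⟩)` (`semigroup_le_two_of_seven_le`, Strassen):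
at `n = 2` ALL of the obstruction is torsion; the cell `(2,6)` is open.  The two named facts enter as explicit hypotheses
(their discharging modules are separate files).
No proposition is defined; no `def`; sorry-free; standard axioms.  Nothing here proves `ω = 2` or closes an item.
[cite: BurgisserIkenmeyer2011, Def. 3.1, Lemma 6.1, Problem 8.3] [cite: vandenBergChristandlLysikovNieuwboerWalterZuiddam2025, §1]
[cite: BurgisserIkenmeyer2017, §5] [cite: Strassen1969]
-/

noncomputable section

open scoped BigOperators

namespace Summit.MatrixMultiplication.MatrixMultiplication.Theorems.ObstructionCalculus

open Literature.Computability.AlgebraicComplexity (kroneckerPow kroneckerPow_zero isotypicSum₁ isotypicSum₂ isotypicSum₃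
  permLegs₁_apply permLegs₂_apply permLegs₃_apply matMulTensor unitTensor tensorRank
  exists_isotypicSum₁₂₃_kroneckerPow_mul_ne_zero vandenBergEtAl2025_unitTensor_four_polytope_maximal
  tensorRank_matMulTensor_two_le_seven spechtCharacter_one_ne_zero)
open Literature.NumberTheory.DiophantineGeometry (spechtCharacter)
open Summit.MatrixMultiplication.MatrixMultiplication.Theses.ObstructionDescent (NoOccurrenceObstruction)

/-! ## §0  Degree zero: the empty triple occurs in every tensor -/

/-- Every permutation of `Fin 0` is the identity. [folklore] -/
theorem perm_fin_zero_eq_one (π : Equiv.Perm (Fin 0)) : π = 1 :=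
  Equiv.ext fun i => i.elim0

/-- `S_0 = {1}` as a `Finset`. [folklore] -/
theorem univ_perm_fin_zero : (Finset.univ : Finset (Equiv.Perm (Fin 0))) = {1} :=
  Finset.eq_singleton_iff_unique_mem.2 ⟨Finset.mem_univ _, fun π _ => perm_fin_zero_eq_one π⟩

/-- In degree `0` the isotypic sum on the first factor is multiplication by the scalar `χ_λ(1)`. [folklore] -/
theorem isotypicSum₁_degree_zero {ι κ μ : Type} (lam : Nat.Partition 0)
    (u : (Fin 0 → ι) → (Fin 0 → κ) → (Fin 0 → μ) → ℂ) :
    isotypicSum₁ lam u = spechtCharacter ℂ lam 1 • u := by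
  simp only [isotypicSum₁, univ_perm_fin_zero, Finset.sum_singleton]
  congr 1

/-- In degree `0` the isotypic sum on the second factor is multiplication by `χ_λ(1)`. [folklore] -/
theorem isotypicSum₂_degree_zero {ι κ μ : Type} (lam : Nat.Partition 0)
    (u : (Fin 0 → ι) → (Fin 0 → κ) → (Fin 0 → μ) → ℂ) :
    isotypicSum₂ lam u = spechtCharacter ℂ lam 1 • u := by
  simp only [isotypicSum₂, univ_perm_fin_zero, Finset.sum_singleton]
  congr 1

/-- In degree `0` the isotypic sum on the third factor is multiplication by `χ_λ(1)`. [folklore] -/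
theorem isotypicSum₃_degree_zero {ι κ μ : Type} (lam : Nat.Partition 0)
    (u : (Fin 0 → ι) → (Fin 0 → κ) → (Fin 0 → μ) → ℂ) :
    isotypicSum₃ lam u = spechtCharacter ℂ lam 1 • u := by
  simp only [isotypicSum₃, univ_perm_fin_zero, Finset.sum_singleton]
  congr 1

/-- **The degree-`0` triple occurs in every tensor**: `t^{⊗0} = 1` and the three degree-`0` isotypic sums are the non-zero
scalars `χ_λ(1)`.  (Bookkeeping for the `d = 0` corner of the split below.) [folklore] -/
theorem isotypicSum₁₂₃_kroneckerPow_zero_ne_zero {ι κ μ : Type} (t : ι → κ → μ → ℂ) (lam : Fin 3 → Nat.Partition 0) :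
    isotypicSum₁ (lam 0) (isotypicSum₂ (lam 1) (isotypicSum₃ (lam 2) (kroneckerPow t 0))) ≠ 0 := by
  rw [isotypicSum₁_degree_zero, isotypicSum₂_degree_zero, isotypicSum₃_degree_zero]
  intro h
  have h' := congr_fun (congr_fun (congr_fun h Fin.elim0) Fin.elim0) Fin.elim0
  simp only [Pi.smul_apply, smul_eq_mul, kroneckerPow_zero, mul_one, Pi.zero_apply, mul_eq_zero] at h'
  rcases h' with h0 | h1 | h2
  · exact spechtCharacter_one_ne_zero _ h0
  · exact spechtCharacter_one_ne_zero _ h1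
  · exact spechtCharacter_one_ne_zero _ h2

/-! ## §1  A semigroup containment is SAT ∧ TOR (any two tensors) -/

/-- **`S(s) ⊆ S(t) ⟺ SAT(s,t) ∧ TOR(s,t)`** for arbitrary `3`-tensors `s, t`:
SAT = every triple occurring in a positive power of `s` has a positive multiple occurring in the corresponding power of `t`;
TOR = a triple occurring in a power of `s` some positive multiple of which occurs for `t` occurs for `t` itself.
(`⟹`: take `k = 1`, resp. ignore the multiple; `⟸`: compose, the degree-`0` triple occurring everywhere.)
[cite: BurgisserIkenmeyer2011, Def. 3.1, §10.1] -/
theorem semigroup_le_iff_sat_and_tor {ι κ μ ι' κ' μ' : Type} [Fintype ι] [Fintype κ] [Fintype μ]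
    [Fintype ι'] [Fintype κ'] [Fintype μ'] (s : ι → κ → μ → ℂ) (t : ι' → κ' → μ' → ℂ) :
    (∀ (d : ℕ) (lam : Fin 3 → Nat.Partition d),
        isotypicSum₁ (lam 0) (isotypicSum₂ (lam 1) (isotypicSum₃ (lam 2) (kroneckerPow s d))) ≠ 0 →
        isotypicSum₁ (lam 0) (isotypicSum₂ (lam 1) (isotypicSum₃ (lam 2) (kroneckerPow t d))) ≠ 0) ↔
    ((∀ (d : ℕ) (lam : Fin 3 → Nat.Partition d), 0 < d →
        isotypicSum₁ (lam 0) (isotypicSum₂ (lam 1) (isotypicSum₃ (lam 2) (kroneckerPow s d))) ≠ 0 →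
        ∃ (k : ℕ) (mu : Fin 3 → Nat.Partition (k * d)), 0 < k ∧
          (∀ j, (mu j).parts = (lam j).parts.map (fun p => k * p)) ∧
          isotypicSum₁ (mu 0) (isotypicSum₂ (mu 1) (isotypicSum₃ (mu 2) (kroneckerPow t (k * d)))) ≠ 0) ∧
      (∀ (d : ℕ) (lam : Fin 3 → Nat.Partition d) (k : ℕ) (mu : Fin 3 → Nat.Partition (k * d)), 0 < k →
        (∀ j, (mu j).parts = (lam j).parts.map (fun p => k * p)) →
        isotypicSum₁ (lam 0) (isotypicSum₂ (lam 1) (isotypicSum₃ (lam 2) (kroneckerPow s d))) ≠ 0 →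
        isotypicSum₁ (mu 0) (isotypicSum₂ (mu 1) (isotypicSum₃ (mu 2) (kroneckerPow t (k * d)))) ≠ 0 →
        isotypicSum₁ (lam 0) (isotypicSum₂ (lam 1) (isotypicSum₃ (lam 2) (kroneckerPow t d))) ≠ 0)) := by
  constructor
  · intro h
    refine ⟨fun d lam _ hs => ?_, fun d lam k mu _ _ hs _ => h d lam hs⟩
    obtain ⟨mu, hmu, hocc⟩ := exists_isotypicSum₁₂₃_kroneckerPow_mul_ne_zero (h d lam hs) Nat.one_pos
    exact ⟨1, mu, Nat.one_pos, hmu, hocc⟩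
  · rintro ⟨hsat, htor⟩ d lam hs
    rcases Nat.eq_zero_or_pos d with rfl | hd
    · exact isotypicSum₁₂₃_kroneckerPow_zero_ne_zero t lam
    · obtain ⟨k, mu, hk, hmu, hocc⟩ := hsat d lam hd hs
      exact htor d lam k mu hk hmu hs hocc

/-- **A failed containment at a SAT cell is a torsion failure**: if `SAT(s,t)` holds and some triple occurs for `s` but not
for `t`, then `TOR(s,t)` fails (witnessed by that triple and the multiple SAT provides). [cite: BurgisserIkenmeyer2011, §10.1] -/
theorem not_tor_of_sat_of_witness {ι κ μ ι' κ' μ' : Type} [Fintype ι] [Fintype κ] [Fintype μ]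
    [Fintype ι'] [Fintype κ'] [Fintype μ'] (s : ι → κ → μ → ℂ) (t : ι' → κ' → μ' → ℂ)
    (hsat : ∀ (d : ℕ) (lam : Fin 3 → Nat.Partition d), 0 < d →
        isotypicSum₁ (lam 0) (isotypicSum₂ (lam 1) (isotypicSum₃ (lam 2) (kroneckerPow s d))) ≠ 0 →
        ∃ (k : ℕ) (mu : Fin 3 → Nat.Partition (k * d)), 0 < k ∧
          (∀ j, (mu j).parts = (lam j).parts.map (fun p => k * p)) ∧
          isotypicSum₁ (mu 0) (isotypicSum₂ (mu 1) (isotypicSum₃ (mu 2) (kroneckerPow t (k * d)))) ≠ 0)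
    {d : ℕ} (hd : 0 < d) (lam : Fin 3 → Nat.Partition d)
    (hs : isotypicSum₁ (lam 0) (isotypicSum₂ (lam 1) (isotypicSum₃ (lam 2) (kroneckerPow s d))) ≠ 0)
    (ht : isotypicSum₁ (lam 0) (isotypicSum₂ (lam 1) (isotypicSum₃ (lam 2) (kroneckerPow t d))) = 0) :
    ¬ (∀ (d : ℕ) (lam : Fin 3 → Nat.Partition d) (k : ℕ) (mu : Fin 3 → Nat.Partition (k * d)), 0 < k →
        (∀ j, (mu j).parts = (lam j).parts.map (fun p => k * p)) →
        isotypicSum₁ (lam 0) (isotypicSum₂ (lam 1) (isotypicSum₃ (lam 2) (kroneckerPow s d))) ≠ 0 →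
        isotypicSum₁ (mu 0) (isotypicSum₂ (mu 1) (isotypicSum₃ (mu 2) (kroneckerPow t (k * d)))) ≠ 0 →
        isotypicSum₁ (lam 0) (isotypicSum₂ (lam 1) (isotypicSum₃ (lam 2) (kroneckerPow t d))) ≠ 0) := by
  intro htor
  obtain ⟨k, mu, hk, hmu, hocc⟩ := hsat d lam hd hs
  exact htor d lam k mu hk hmu hs hocc ht

/-! ## §2  The crux:  `P_O ⟺ SAT-family ∧ TOR-family` -/

/-- **`P_O` splits exactly into saturation and torsion.**  With `m₀(n,τ) = max(n², ⌈n^τ⌉)`: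
`NoOccurrenceObstruction ⟺ (∀ τ > 2, eventually SAT(⟨n,n,n⟩, ⟨m₀⟩)) ∧ (∀ τ > 2, eventually TOR(⟨n,n,n⟩, ⟨m₀⟩))`.
The first conjunct says no occurrence obstruction against `bR(⟨n,n,n⟩) ≤ n^{2+o(1)}` survives stretching (polytope
containment `Δ(⟨n,n,n⟩) ⊆ Δ(⟨m₀⟩)`); the second says the holes of the unit-tensor semigroups are invisible from `S(⟨n,n,n⟩)`.
[cite: BurgisserIkenmeyer2011, Def. 3.1, Lemma 6.1, Problem 8.3] -/
theorem noOccurrenceObstruction_iff_sat_and_tor :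
    NoOccurrenceObstruction ↔
      (∀ τ : ℝ, 2 < τ → ∃ n₀ : ℕ, ∀ n : ℕ, n₀ ≤ n → ∀ (d : ℕ) (lam : Fin 3 → Nat.Partition d), 0 < d →
        isotypicSum₁ (lam 0) (isotypicSum₂ (lam 1) (isotypicSum₃ (lam 2)
          (kroneckerPow (matMulTensor ℂ n n n) d))) ≠ 0 →
        ∃ (k : ℕ) (mu : Fin 3 → Nat.Partition (k * d)), 0 < k ∧
          (∀ j, (mu j).parts = (lam j).parts.map (fun p => k * p)) ∧
          isotypicSum₁ (mu 0) (isotypicSum₂ (mu 1) (isotypicSum₃ (mu 2)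
            (kroneckerPow (unitTensor ℂ (max (n * n) ⌈(n : ℝ) ^ τ⌉₊)) (k * d)))) ≠ 0) ∧
      (∀ τ : ℝ, 2 < τ → ∃ n₀ : ℕ, ∀ n : ℕ, n₀ ≤ n → ∀ (d : ℕ) (lam : Fin 3 → Nat.Partition d) (k : ℕ)
        (mu : Fin 3 → Nat.Partition (k * d)), 0 < k → (∀ j, (mu j).parts = (lam j).parts.map (fun p => k * p)) →
        isotypicSum₁ (lam 0) (isotypicSum₂ (lam 1) (isotypicSum₃ (lam 2)
          (kroneckerPow (matMulTensor ℂ n n n) d))) ≠ 0 →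
        isotypicSum₁ (mu 0) (isotypicSum₂ (mu 1) (isotypicSum₃ (mu 2)
          (kroneckerPow (unitTensor ℂ (max (n * n) ⌈(n : ℝ) ^ τ⌉₊)) (k * d)))) ≠ 0 →
        isotypicSum₁ (lam 0) (isotypicSum₂ (lam 1) (isotypicSum₃ (lam 2)
          (kroneckerPow (unitTensor ℂ (max (n * n) ⌈(n : ℝ) ^ τ⌉₊)) d))) ≠ 0) := by
  rw [noOccurrenceObstruction_iff_minFormat_semigroup]
  constructor
  · intro h
    refine ⟨fun τ hτ => ?_, fun τ hτ => ?_⟩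
    · obtain ⟨n₀, hn₀⟩ := h τ hτ
      exact ⟨n₀, fun n hn => ((semigroup_le_iff_sat_and_tor _ _).1 (hn₀ n hn)).1⟩
    · obtain ⟨n₀, hn₀⟩ := h τ hτ
      exact ⟨n₀, fun n hn => ((semigroup_le_iff_sat_and_tor _ _).1 (hn₀ n hn)).2⟩
  · rintro ⟨hsat, htor⟩ τ hτ
    obtain ⟨n₁, hn₁⟩ := hsat τ hτ
    obtain ⟨n₂, hn₂⟩ := htor τ hτ
    exact ⟨max n₁ n₂, fun n hn =>
      (semigroup_le_iff_sat_and_tor _ _).2 ⟨hn₁ n (le_of_max_le_left hn), hn₂ n (le_of_max_le_right hn)⟩⟩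

/-! ## §3  SAT from unit-tensor polytope maximality (a matrix-multiplication-free sufficient condition) -/

/-- **Polytope maximality at all large formats gives the SAT-family.**  If for every format `m ≥ m₁` every triple occurring
in a positive power of ANY tensor of format `≤ m` has a positive multiple occurring for `⟨m⟩` (`Δ(⟨m⟩) = Kron(m,m,m)`,
Bürgisser–Ikenmeyer Problem 8.3, in the semigroup form of `vandenBergEtAl2025_unitTensor_four_polytope_maximal` with
`4 ↦ m`), then the SAT half of `P_O` holds — at `n ≥ m₁`, since `⟨n,n,n⟩` has format `n² ≤ m₀(n,τ)`.
[cite: BurgisserIkenmeyer2011, Problem 8.3] [cite: vandenBergChristandlLysikovNieuwboerWalterZuiddam2025, §1] -/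
theorem sat_family_of_unitTensor_polytope_maximal (m₁ : ℕ)
    (hmax : ∀ m : ℕ, m₁ ≤ m → ∀ {ι κ μ : Type} [Fintype ι] [Fintype κ] [Fintype μ],
      Fintype.card ι ≤ m → Fintype.card κ ≤ m → Fintype.card μ ≤ m →
      ∀ (s : ι → κ → μ → ℂ) (d : ℕ) (lam : Fin 3 → Nat.Partition d), 0 < d →
        isotypicSum₁ (lam 0) (isotypicSum₂ (lam 1) (isotypicSum₃ (lam 2) (kroneckerPow s d))) ≠ 0 →
        ∃ (k : ℕ) (mu : Fin 3 → Nat.Partition (k * d)), 0 < k ∧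
          (∀ j, (mu j).parts = (lam j).parts.map (fun p => k * p)) ∧
          isotypicSum₁ (mu 0) (isotypicSum₂ (mu 1) (isotypicSum₃ (mu 2) (kroneckerPow (unitTensor ℂ m) (k * d)))) ≠ 0) :
    ∀ τ : ℝ, 2 < τ → ∃ n₀ : ℕ, ∀ n : ℕ, n₀ ≤ n → ∀ (d : ℕ) (lam : Fin 3 → Nat.Partition d), 0 < d →
      isotypicSum₁ (lam 0) (isotypicSum₂ (lam 1) (isotypicSum₃ (lam 2)
        (kroneckerPow (matMulTensor ℂ n n n) d))) ≠ 0 →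
      ∃ (k : ℕ) (mu : Fin 3 → Nat.Partition (k * d)), 0 < k ∧
        (∀ j, (mu j).parts = (lam j).parts.map (fun p => k * p)) ∧
        isotypicSum₁ (mu 0) (isotypicSum₂ (mu 1) (isotypicSum₃ (mu 2)
          (kroneckerPow (unitTensor ℂ (max (n * n) ⌈(n : ℝ) ^ τ⌉₊)) (k * d)))) ≠ 0 := by
  intro τ _
  refine ⟨m₁, fun n hn d lam hd hs => ?_⟩
  have hcard : Fintype.card (Fin n × Fin n) ≤ max (n * n) ⌈(n : ℝ) ^ τ⌉₊ := by
    simp only [Fintype.card_prod, Fintype.card_fin]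
    exact le_max_left _ _
  have hm : m₁ ≤ max (n * n) ⌈(n : ℝ) ^ τ⌉₊ := hn.trans ((Nat.le_mul_self n).trans (le_max_left _ _))
  exact hmax _ hm hcard hcard hcard (matMulTensor ℂ n n n) d lam hd hs

/-! ## §4  The cell `n = 2`: SAT everywhere, the obstruction at `m ∈ {4,5}` is pure torsion -/

/-- **SAT at `n = 2` for every format `m ≥ 4`** (given the `4×4×4` unit-tensor polytope maximality): a triple occurring in
`⟨2,2,2⟩^{⊗d}`, `d > 0`, has a positive multiple occurring in `⟨4⟩^{⊗kd}`, hence in `⟨m⟩^{⊗kd}` (format monotonicity).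
[cite: vandenBergChristandlLysikovNieuwboerWalterZuiddam2025, §1 after Cor. 1.5] [cite: BurgisserIkenmeyer2011, §3.1] -/
theorem sat_two_of_four_polytope_maximal (h444 : vandenBergEtAl2025_unitTensor_four_polytope_maximal)
    {m : ℕ} (hm : 4 ≤ m) (d : ℕ) (lam : Fin 3 → Nat.Partition d) (hd : 0 < d)
    (hs : isotypicSum₁ (lam 0) (isotypicSum₂ (lam 1) (isotypicSum₃ (lam 2)
      (kroneckerPow (matMulTensor ℂ 2 2 2) d))) ≠ 0) :
    ∃ (k : ℕ) (mu : Fin 3 → Nat.Partition (k * d)), 0 < k ∧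
      (∀ j, (mu j).parts = (lam j).parts.map (fun p => k * p)) ∧
      isotypicSum₁ (mu 0) (isotypicSum₂ (mu 1) (isotypicSum₃ (mu 2) (kroneckerPow (unitTensor ℂ m) (k * d)))) ≠ 0 := by
  have hcard : Fintype.card (Fin 2 × Fin 2) ≤ 4 := by simp
  obtain ⟨k, mu, hk, hmu, hocc⟩ := h444 hcard hcard hcard (matMulTensor ℂ 2 2 2) d lam hd hs
  exact ⟨k, mu, hk, hmu, isotypicSum_kroneckerPow_unitTensor_mono hm mu hocc⟩

/-- **At `n = 2` a non-containment witness at format `5` is a TORSION failure at formats `4` and `5`** (given the `4×4×4`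
maximality): if `λ ⊢ d > 0` occurs in `⟨2,2,2⟩^{⊗d}` but not in `⟨5⟩^{⊗d}` — Bürgisser–Ikenmeyer's
`λ₂ = ((5,1,1,1),(2,2,2,2),(2,2,2,2)) ⊢ 8` is such a triple (Lemma 6.1; tree theorem `burgisserIkenmeyer2011_lemma_6_1_holds`)
— then `TOR(⟨2,2,2⟩, ⟨m⟩)` fails for `4 ≤ m ≤ 5`, although `SAT(⟨2,2,2⟩, ⟨m⟩)` holds there.
[cite: BurgisserIkenmeyer2011, Lemma 6.1] [cite: vandenBergChristandlLysikovNieuwboerWalterZuiddam2025, §1] -/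
theorem not_tor_two_of_witness (h444 : vandenBergEtAl2025_unitTensor_four_polytope_maximal)
    {d : ℕ} (hd : 0 < d) (lam : Fin 3 → Nat.Partition d)
    (hs : isotypicSum₁ (lam 0) (isotypicSum₂ (lam 1) (isotypicSum₃ (lam 2)
      (kroneckerPow (matMulTensor ℂ 2 2 2) d))) ≠ 0)
    (ht5 : isotypicSum₁ (lam 0) (isotypicSum₂ (lam 1) (isotypicSum₃ (lam 2) (kroneckerPow (unitTensor ℂ 5) d))) = 0)
    {m : ℕ} (hm4 : 4 ≤ m) (hm5 : m ≤ 5) :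
    ¬ (∀ (d : ℕ) (lam : Fin 3 → Nat.Partition d) (k : ℕ) (mu : Fin 3 → Nat.Partition (k * d)), 0 < k →
        (∀ j, (mu j).parts = (lam j).parts.map (fun p => k * p)) →
        isotypicSum₁ (lam 0) (isotypicSum₂ (lam 1) (isotypicSum₃ (lam 2)
          (kroneckerPow (matMulTensor ℂ 2 2 2) d))) ≠ 0 →
        isotypicSum₁ (mu 0) (isotypicSum₂ (mu 1) (isotypicSum₃ (mu 2) (kroneckerPow (unitTensor ℂ m) (k * d)))) ≠ 0 →
        isotypicSum₁ (lam 0) (isotypicSum₂ (lam 1) (isotypicSum₃ (lam 2) (kroneckerPow (unitTensor ℂ m) d))) ≠ 0) := by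
  have htm : isotypicSum₁ (lam 0) (isotypicSum₂ (lam 1) (isotypicSum₃ (lam 2)
      (kroneckerPow (unitTensor ℂ m) d))) = 0 := by
    by_contra h
    exact isotypicSum_kroneckerPow_unitTensor_mono hm5 lam h ht5
  exact not_tor_of_sat_of_witness (matMulTensor ℂ 2 2 2) (unitTensor ℂ m)
    (fun d lam hd hs => sat_two_of_four_polytope_maximal h444 hm4 d lam hd hs) hd lam hs htm

/-- **… and the containment itself fails there** (no maximality needed): a triple occurring for `⟨2,2,2⟩` and not for `⟨5⟩`
refutes `S(⟨2,2,2⟩) ⊆ S(⟨m⟩)` for every `m ≤ 5`. [cite: BurgisserIkenmeyer2011, Lemma 6.1] -/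
theorem not_semigroup_le_two_of_witness {d : ℕ} (lam : Fin 3 → Nat.Partition d)
    (hs : isotypicSum₁ (lam 0) (isotypicSum₂ (lam 1) (isotypicSum₃ (lam 2)
      (kroneckerPow (matMulTensor ℂ 2 2 2) d))) ≠ 0)
    (ht5 : isotypicSum₁ (lam 0) (isotypicSum₂ (lam 1) (isotypicSum₃ (lam 2) (kroneckerPow (unitTensor ℂ 5) d))) = 0)
    {m : ℕ} (hm5 : m ≤ 5) :
    ¬ (∀ (d : ℕ) (lam : Fin 3 → Nat.Partition d),
        isotypicSum₁ (lam 0) (isotypicSum₂ (lam 1) (isotypicSum₃ (lam 2)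
          (kroneckerPow (matMulTensor ℂ 2 2 2) d))) ≠ 0 →
        isotypicSum₁ (lam 0) (isotypicSum₂ (lam 1) (isotypicSum₃ (lam 2) (kroneckerPow (unitTensor ℂ m) d))) ≠ 0) :=
  fun h => isotypicSum_kroneckerPow_unitTensor_mono hm5 lam (h d lam hs) ht5

/-- **At `n = 2` everything holds from format `7 = R(⟨2,2,2⟩)` on** (Strassen): `S(⟨2,2,2⟩) ⊆ S(⟨m⟩)` for `m ≥ 7`, hence
SAT and TOR there (`semigroup_le_iff_sat_and_tor`).  The cell `m = 6` is open. [cite: Strassen1969]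
[cite: BurgisserIkenmeyer2011, §3.1] -/
theorem semigroup_le_two_of_seven_le {m : ℕ} (hm : 7 ≤ m) (d : ℕ) (lam : Fin 3 → Nat.Partition d)
    (hs : isotypicSum₁ (lam 0) (isotypicSum₂ (lam 1) (isotypicSum₃ (lam 2)
      (kroneckerPow (matMulTensor ℂ 2 2 2) d))) ≠ 0) :
    isotypicSum₁ (lam 0) (isotypicSum₂ (lam 1) (isotypicSum₃ (lam 2) (kroneckerPow (unitTensor ℂ m) d))) ≠ 0 :=
  semigroup_containment_of_tensorRank_le 2 m (by omega) ((tensorRank_matMulTensor_two_le_seven ℂ).trans hm) lam hs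

/-- **TOR at `n = 2` for `m ≥ 7`** (from the containment). [cite: Strassen1969] -/
theorem tor_two_of_seven_le {m : ℕ} (hm : 7 ≤ m) (d : ℕ) (lam : Fin 3 → Nat.Partition d) (k : ℕ)
    (mu : Fin 3 → Nat.Partition (k * d)) (_hk : 0 < k) (_hmu : ∀ j, (mu j).parts = (lam j).parts.map (fun p => k * p))
    (hs : isotypicSum₁ (lam 0) (isotypicSum₂ (lam 1) (isotypicSum₃ (lam 2)
      (kroneckerPow (matMulTensor ℂ 2 2 2) d))) ≠ 0)
    (_ht : isotypicSum₁ (mu 0) (isotypicSum₂ (mu 1) (isotypicSum₃ (mu 2) (kroneckerPow (unitTensor ℂ m) (k * d)))) ≠ 0) :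
    isotypicSum₁ (lam 0) (isotypicSum₂ (lam 1) (isotypicSum₃ (lam 2) (kroneckerPow (unitTensor ℂ m) d))) ≠ 0 :=
  semigroup_le_two_of_seven_le hm d lam hs

end Summit.MatrixMultiplication.MatrixMultiplication.Theorems.ObstructionCalculus

end
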